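/-
Copyright (c) 2026 the pub-hodgecm-mathlib formalisation cell (harness21).  Prover seat hodgecm-mathlib-B-p04 (g30), floor 0, programme P5
(Alb-CM), row «split half of h1» FILE (A) (desk F0P5-plan (g4), 2026-08-31).  KERNEL module: THEOREMS ONLY (no definition, no named fact,
no `sorry`, no instance, no notation).
-/
import Literature.NumberTheory.Automorphic.UnitaryGroupDualPairLocalLine
import HarnessLib

/-!
# `k ↦ reindex e (k ⊗ 1) : U(J_V)(F_v) → U(J_V ⊗ J_W)(F_v)` is a HOMEOMORPHIC isomorphism for a LINE `W`: the inverse and the open-map property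

Topic `NumberTheory/Automorphic`; namespace `Literature.NumberTheory.Automorphic.UnitaryGroup`.  KERNEL: theorems only.  Sequel of ★
`UnitaryGroupDualPairLocalLine` (`localLineInl`, `localLineInl_surjective`).

For a hermitian LINE `W = ⟨j⟩` (`J_W = (j)`, `j ≠ 0`) the first member `a : U(V) → U(V ⊗ W)`, `k ↦ k ⊗ 1`, of the dual pair
([GelbartRogawski1991, §3.2]; [MoeglinVignerasWaldspurger1987, Chap. 1 I.17]) is a bijection `U(J_V)(F_v) ≃ U(J_V ⊗ J_W)(F_v)`
(«`U(V ⊗ W) = U(V)` when `dim W = 1`», [Liu2021, App. D §D.1]); the tree has it as a monoid homomorphism with ★ `localLineInl_surjective`.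
This file supplies the INVERSE on the nose and the consequence the representation theory needs — `localLineInl v` is an OPEN MAP — so that
admissibility passes from `U(J_V ⊗ J_W)(F_v)`-modules to their restrictions along `localLineInl v` (★ `Representation.IsAdmissible.comp_of_continuous_of_isOpenMap`):

* `reindexGL_lineEquiv_symm_localLineGL` — `reindex σ⁻¹ (reindex e (k_w ⊗ 1)) = k_w`, `σ := (Fin N ≃ Fin N × Fin 1) ≫ e`;
* `localLineGL_reindexGL_lineEquiv_symm` — `reindex e ((reindex σ⁻¹ g_w) ⊗ 1) = g_w`;
* `reindexGL_lineEquiv_symm_mem_localPi` — the inverse lands in `U(J_V)(F_v)` (★ `localLineGL_mem_iff`);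
* **`isOpenMap_localLineInl`** — `localLineInl v` is open (`IsOpenMap.of_inverse`: the inverse `g ↦ (reindex σ⁻¹ g_w)_w` is continuous, ★
  `continuous_reindexGL`), and `localLineInl_injective`.

Count-neutral plumbing; HC_CM is proved only modulo the printed citations until rung 0 closes.

## References
* [GelbartRogawski1991] S. Gelbart, J. Rogawski, Invent. Math. 105 (1991), §3.2 p. 457.
* [MoeglinVignerasWaldspurger1987] C. Mœglin, M.-F. Vignéras, J.-L. Waldspurger, LNM 1291, Chap. 1 I.17 (dual pairs `U(V) × U(W) → U(V ⊗ W)`).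
* [Liu2021] Y. Liu, Camb. J. Math. 9 (2021) = arXiv:2102.11518, App. D §D.1 (l. 5213–5224).
-/

set_option autoImplicit false

noncomputable section

open scoped Matrix Kronecker Classical
open NumberField IsDedekindDomain

namespace Literature.NumberTheory.Automorphic.UnitaryGroup

variable (F E : Type) [Field F] [NumberField F] [Field E] [NumberField E] [Algebra F E]
variable (c : E ≃ₐ[F] E) (N : ℕ) {n : ℕ} (e : Fin N × Fin 1 ≃ Fin n)
variable (JV : Matrix (Fin N) (Fin N) E) (JW : Matrix (Fin 1) (Fin 1) E)

variable {F}

omit [NumberField F] [NumberField E] in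
/-- `reindex σ⁻¹ (reindex e (K ⊗ 1)) = K` for `σ = (Fin N ≃ Fin N × Fin 1) ≫ e` (matrices). [cite: MoeglinVignerasWaldspurger1987, Chap. 1 I.17] -/
private theorem reindex_symm_reindex_kronecker_one {R : Type*} [CommRing R] (K : Matrix (Fin N) (Fin N) R) :
    Matrix.reindex ((Equiv.prodUnique (Fin N) (Fin 1)).symm.trans e).symm ((Equiv.prodUnique (Fin N) (Fin 1)).symm.trans e).symm
        (Matrix.reindex e e (K ⊗ₖ (1 : Matrix (Fin 1) (Fin 1) R))) = K := by
  ext i j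
  simp only [Matrix.reindex_apply, Matrix.submatrix_apply, Equiv.symm_symm, Equiv.trans_apply, Equiv.symm_apply_apply,
    Matrix.kroneckerMap_apply, Equiv.prodUnique_symm_apply, Matrix.one_apply_eq, mul_one]

omit [NumberField F] [NumberField E] in
/-- `reindex e ((reindex σ⁻¹ M) ⊗ 1) = M` for `σ = (Fin N ≃ Fin N × Fin 1) ≫ e` (matrices). [cite: MoeglinVignerasWaldspurger1987, Chap. 1 I.17] -/
private theorem reindex_kronecker_one_reindex_symm {R : Type*} [CommRing R] (M : Matrix (Fin n) (Fin n) R) :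
    Matrix.reindex e e (Matrix.reindex ((Equiv.prodUnique (Fin N) (Fin 1)).symm.trans e).symm
        ((Equiv.prodUnique (Fin N) (Fin 1)).symm.trans e).symm M ⊗ₖ (1 : Matrix (Fin 1) (Fin 1) R)) = M := by
  ext i j
  have h1 : ∀ x : Fin N × Fin 1, (x.1, (default : Fin 1)) = x := fun x => Prod.ext rfl (Subsingleton.elim _ _)
  have h2 : ∀ a b : Fin 1, (1 : Matrix (Fin 1) (Fin 1) R) a b = 1 := fun a b => by
    rw [Subsingleton.elim a b, Matrix.one_apply_eq]
  simp only [Matrix.reindex_apply, Matrix.submatrix_apply, Matrix.kroneckerMap_apply, Equiv.symm_symm, Equiv.trans_apply,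
    Equiv.prodUnique_symm_apply, h1, Equiv.apply_symm_apply, h2, mul_one]

omit [NumberField F] in
/-- **left inverse on the factor**: `reindex σ⁻¹ ((k ⊗ 1)_w) = k_w` in `GL_N(E_w)`. [cite: MoeglinVignerasWaldspurger1987, Chap. 1 I.17] -/
theorem reindexGL_lineEquiv_symm_localLineGL (v : HeightOneSpectrum (𝓞 F)) (k : LocalGLPi E N v) (w : PlacesOver E v) :
    reindexGL ((Equiv.prodUnique (Fin N) (Fin 1)).symm.trans e).symm (localLineGL E N e v k w) = k w :=
  Units.ext (by rw [coe_reindexGL, coe_localLineGL_apply, reindex_symm_reindex_kronecker_one])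

omit [NumberField F] in
/-- **right inverse on the factor**: `(reindex σ⁻¹ g_w)_w ↦ reindex e (· ⊗ 1)` gives back `g`. [cite: MoeglinVignerasWaldspurger1987, Chap. 1 I.17] -/
theorem localLineGL_reindexGL_lineEquiv_symm (v : HeightOneSpectrum (𝓞 F)) (g : LocalGLPi E n v) :
    localLineGL E N e v (fun w => reindexGL ((Equiv.prodUnique (Fin N) (Fin 1)).symm.trans e).symm (g w)) = g :=
  funext fun w => Units.ext (by rw [coe_localLineGL_apply, coe_reindexGL, reindex_kronecker_one_reindex_symm])

/-- **the inverse lands in `U(J_V)(F_v)`**: for `g ∈ U(J_V ⊗ J_W)(F_v)` (`J_W = (j)`, `j ≠ 0`) the family `(reindex σ⁻¹ g_w)_w` is in `U(J_V)(F_v)`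
(★ `localLineGL_mem_iff`). [cite: MoeglinVignerasWaldspurger1987, Chap. 1 I.17] [cite: Liu2021, App. D §D.1 (l. 5213–5224)] -/
theorem reindexGL_lineEquiv_symm_mem_localPi (hJW0 : JW 0 0 ≠ 0) (v : HeightOneSpectrum (𝓞 F))
    (g : localPi E c n (Matrix.reindex e e (JV ⊗ₖ JW)) v) :
    (fun w => reindexGL ((Equiv.prodUnique (Fin N) (Fin 1)).symm.trans e).symm ((g : LocalGLPi E n v) w)) ∈ localPi E c N JV v := by
  rw [← localLineGL_mem_iff E c N e JV JW hJW0 v, localLineGL_reindexGL_lineEquiv_symm]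
  exact g.2

/-- `localLineInl v` is injective (`reindex σ⁻¹` is a left inverse factorwise). [cite: MoeglinVignerasWaldspurger1987, Chap. 1 I.17] -/
theorem localLineInl_injective (v : HeightOneSpectrum (𝓞 F)) : Function.Injective (localLineInl E c N e JV JW v) := by
  intro k₁ k₂ h
  apply Subtype.ext
  funext w
  have h' := congrArg (fun g : localPi E c n (Matrix.reindex e e (JV ⊗ₖ JW)) v =>
    reindexGL ((Equiv.prodUnique (Fin N) (Fin 1)).symm.trans e).symm ((g : LocalGLPi E n v) w)) h
  simpa only [coe_localLineInl, reindexGL_lineEquiv_symm_localLineGL] using h'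

/-- **`localLineInl v : U(J_V)(F_v) → U(J_V ⊗ J_W)(F_v)` is an OPEN MAP for a line `J_W = (j)`, `j ≠ 0`** — it has the continuous
two-sided inverse `g ↦ (reindex σ⁻¹ g_w)_w` (★ `continuous_reindexGL`; `IsOpenMap.of_inverse`).  With ★ `continuous_localLineInl` this makes
`k ↦ k ⊗ 1` a homeomorphic group isomorphism, so admissibility descends along it (★ `Representation.IsAdmissible.comp_of_continuous_of_isOpenMap`).
[cite: MoeglinVignerasWaldspurger1987, Chap. 1 I.17] [cite: Liu2021, App. D §D.1 (l. 5213–5224)] -/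
theorem isOpenMap_localLineInl (hJW0 : JW 0 0 ≠ 0) (v : HeightOneSpectrum (𝓞 F)) : IsOpenMap (localLineInl E c N e JV JW v) := by
  refine IsOpenMap.of_inverse
    (f' := fun g => (⟨_, reindexGL_lineEquiv_symm_mem_localPi E c N e JV JW hJW0 v g⟩ : localPi E c N JV v)) ?_ ?_ ?_
  · exact Continuous.subtype_mk (continuous_pi fun w =>
      (continuous_reindexGL ((Equiv.prodUnique (Fin N) (Fin 1)).symm.trans e).symm).comp
        ((continuous_apply w).comp continuous_subtype_val)) _
  · intro g
    apply Subtype.ext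
    exact localLineGL_reindexGL_lineEquiv_symm E N e v (g : LocalGLPi E n v)
  · intro k
    apply Subtype.ext
    funext w
    exact reindexGL_lineEquiv_symm_localLineGL E N e v (k : LocalGLPi E N v) w

end Literature.NumberTheory.Automorphic.UnitaryGroup

end
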